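import Literature.RingTheory.FormalGroups.CocyclePolynomial
import Mathlib.Data.Nat.Choose.Lucas
import Mathlib.Data.Nat.Multiplicity
import Mathlib.Data.Nat.Factorization.Basic
import Mathlib.Algebra.CharP.Lemmas
import Mathlib.Algebra.Ring.Int.Field
import Mathlib.Algebra.Field.ZMod
import Mathlib.Data.ZMod.QuotientRing
import Mathlib.RingTheory.PrincipalIdealDomain
import Mathlib.RingTheory.SimpleModule.Basic
import Mathlib.RingTheory.Finiteness.Basic
import HarnessLib

/-!
# Lazard's symmetric 2-cocycle lemma (the «comparison lemma») over an ARBITRARY abelian group of coefficients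
# ([Lazard 1955] Lemme 3, p. 257: «Soit K un anneau quelconque. Pour tout entier q ≥ 2, les seuls polynômes P(x, y) ∈ K[x, y]
# homogènes de degré q qui vérifient δP = 0, P(x, y) − P(y, x) = 0 sont de la forme a·C_q(x, y), a ∈ K» — proof §III)

Topic `Literature/RingTheory/FormalGroups`; namespace `Literature.RingTheory.FormalGroups`.  THEOREMS ONLY over the ★ vocabulary
of `CocyclePolynomial.lean` (`lazardNu`, `cocycleCoeff`, `IsSymmCocycle`, `exists_sum_mul_cocycleCoeff_eq_one`); no definition,
no named fact, no instance, no notation, no `sorry`.  Cell `hodgecm-mathlib`, P6 «MOD programme» Row 4B, sub-line P6d «Lubin–Tate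
formal moduli» (`F0_P6d_LubinTateFormalModuli`): the shared combinatorial heart of the LAZARD road to stub (c1) (`L ≅ ℤ[u₂, u₃, …]`
⇐ the indecomposables of the Lazard ring are `ℤ` in each degree ⇐ this lemma for EVERY abelian group of coefficients) and of the
DRINFELD §1 road to stub (c𝒪) (`Λ_𝒪 ≅ 𝒪[g₁, g₂, …]`, the lemma with `𝒪`-module coefficients).  The sibling ★
`LazardComparisonLemmaNilpotent.lean` proves the case of rings with `p` nilpotent by the `p`-adic filtration; here the
coefficients range over ANY additive commutative group.

**THE LEMMA** (`IsSymmCocycle.exists_eq_cocycleCoeff_smul`): for `n ≥ 2` and `a : ℕ → A` a symmetric 2-cocycle of degree `n`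
(★ `IsSymmCocycle n a`: `a_m = 0` for `m > n`, `a_{n-m} = a_m`, and the coefficient identities of
`Γ(Y,Z) + Γ(X,Y+Z) = Γ(X+Y,Z) + Γ(X,Y)`), there is `t ∈ A` — unique (`…existsUnique…`) — with `a_m = c_m · t` for all `m`,
`c_m = C(n,m)/ν(n) =` ★ `cocycleCoeff n m` the coefficients of `C_n = ((X+Y)^n - X^n - Y^n)/ν(n)`.

## Road (our arrangement of [Lazard1955] §III)
* §1 private number theory over Mathlib's Lucas ∕ Kummer: `C(ℓ^t(eℓ+u), ℓ^t u) ≡ 1`, `C(ℓ^r s, ℓ^r) ≡ s (mod ℓ)`, `ℓ ∣ C(ℓ^{t+1}, ℓ^t d)`.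
* §2 THE FIELD CASE (Lazard §III 1°–2°) over any field `K` of prime characteristic `ℓ`: there is a pivot `P = ℓ^r`
  (`r = v_ℓ(n)`, or `v_ℓ(n) - 1` if `n` is a power of `ℓ`) with `b_P = 0 ⇒ b = 0` — zero-propagation along binomial
  coefficients that are units mod `ℓ` (`IsSymmCocycle.apply_eq_zero_of_factorization_lt`, `apply_mul_eq_zero_of_not_dvd`,
  `exists_pivot`).
* §3 DÉVISSAGE (Lazard §III, p. 263 «théorème fondamental sur les groupes abéliens de type fini», here without the structure
  theorem): a finitely generated nonzero abelian group maps ONTO some `ℤ/ℓ` (`exists_addMonoidHom_zmod_surjective`: a coatom,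
  `isSimpleModule_iff_quot_maximal`, `Int.quotientSpanEquivZMod`); with a Bézout vector `Σ w_m c_m = 1` a cocycle with
  `Σ w_m a_m = 0` vanishes (`IsSymmCocycle.eq_zero_of_sum_eq_zero`), whence the lemma and uniqueness.

## References
* [Lazard1955] M. Lazard, *Sur les groupes de Lie formels à un paramètre*, Bull. SMF 83 (1955), 251–274: Lemme 3 (p. 257,
  statement + «les coefficients de C_q sont des entiers premiers entre eux dans leur ensemble»), §III (pp. 261–264, proof:
  relations (3.4)–(3.8), cases 1°–2° over `𝔽_p`, p. 263 the passage to all abelian groups).  Held: `paper:doi-10-24033-bsmf-1462`.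
* Secondary accounts: A. Fröhlich, *Formal Groups*, LNM 74 (1968); C. Rezk, *Notes on the Hopkins–Miller theorem*,
  Contemp. Math. 220 (1998), Lemma 5.3 (held: `paper:doi-10-1090-conm-220-03107`, p. 8).
-/

namespace Literature.RingTheory.FormalGroups

open Finset

/-! ## §0 Reading the ★ structure `IsSymmCocycle` in Lazard's indexing (private adapters) -/

section Adapters

variable {A : Type*} [AddCommGroup A] {n : ℕ} {a : ℕ → A}

/-- `a_m = 0` for `m ≥ n` (`n ≥ 2`). [cite: Lazard1955, §III (3.5) (p. 262)] -/
private theorem IsSymmCocycle.top' (ha : IsSymmCocycle n a) (hn : 2 ≤ n) (m : ℕ) (hm : n ≤ m) : a m = 0 := by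
  rcases hm.eq_or_lt with rfl | hm'
  · exact ha.apply_self (by omega)
  · exact ha.eq_zero_of_lt m hm'

/-- Symmetry read as `a_i = a_{n-i}`. [cite: Lazard1955, Lemme 3 (p. 257)] -/
private theorem IsSymmCocycle.symm' (ha : IsSymmCocycle n a) (i : ℕ) (hi : i ≤ n) : a i = a (n - i) :=
  (ha.symm i hi).symm

/-- The inner relations in Lazard's form `C(n-i, j) a_i = C(i+j, i) a_{i+j}` (`i, j ≥ 1`, `i + j ≤ n-1`).
[cite: Lazard1955, §III (3.6) (p. 262)] -/
private theorem IsSymmCocycle.rel (ha : IsSymmCocycle n a) (i j : ℕ) (hi : 1 ≤ i) (hj : 1 ≤ j) (hij : i + j ≤ n - 1) :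
    (n - i).choose j • a i = (i + j).choose i • a (i + j) := by
  have h := ha.choose_smul_eq (i := i) (j := j) (k := n - i - j) (by omega) (by omega) (by omega)
  rwa [show j + (n - i - j) = n - i by omega] at h

/-- A cocycle vanishing on `1 ≤ i ≤ n-1` vanishes everywhere (`n ≥ 2`). [cite: Lazard1955, §III (3.5) (p. 262)] -/
private theorem IsSymmCocycle.eq_zero_of_forall_mem (ha : IsSymmCocycle n a) (hn : 2 ≤ n)
    (h : ∀ i ∈ Icc 1 (n - 1), a i = 0) (i : ℕ) : a i = 0 := by
  by_cases hi : i ∈ Icc 1 (n - 1)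
  · exact h i hi
  · simp only [mem_Icc, not_and_or, not_le] at hi
    rcases hi with hi | hi
    · have : i = 0 := by omega
      rw [this, ha.apply_zero (by omega)]
    · exact ha.top' hn i (by omega)

end Adapters

/-! ## §1 Number theory: the four binomial coefficients mod `ℓ` (private plumbing over Mathlib's Lucas ∕ Kummer) -/

section NumberTheory

variable {ℓ : ℕ} [hℓ : Fact ℓ.Prime]

/-- Lucas: `C(ℓ^t (e ℓ + u), ℓ^t u) ≡ 1 (mod ℓ)` for `u < ℓ` (the base-`ℓ` digits of the bottom entry are a single digit
`u`, sitting under the digit `u` of the top entry). [folklore] -/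
private theorem choose_pow_mul_modEq_one (t e u : ℕ) (hu : u < ℓ) :
    (ℓ ^ t * (e * ℓ + u)).choose (ℓ ^ t * u) ≡ 1 [MOD ℓ] := by
  refine (Choose.choose_pow_mul_pow_mul_modEq_choose_nat (p := ℓ) (k := t) (a := e * ℓ + u) (b := u)).trans ?_
  refine (Choose.choose_modEq_choose_mod_mul_choose_div_nat (p := ℓ) (n := e * ℓ + u) (k := u)).trans ?_
  have hℓ0 : 0 < ℓ := hℓ.out.pos
  have h1 : (e * ℓ + u) % ℓ = u := by rw [Nat.mul_comm, Nat.mul_add_mod, Nat.mod_eq_of_lt hu]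
  have h2 : (e * ℓ + u) / ℓ = e := by
    rw [Nat.mul_comm, Nat.add_comm, Nat.add_mul_div_left _ _ hℓ0, Nat.div_eq_of_lt hu, zero_add]
  rw [h1, h2, Nat.mod_eq_of_lt hu, Nat.div_eq_of_lt hu, Nat.choose_self, Nat.choose_zero_right, mul_one]

/-- `ℓ ∤ C(ℓ^t (e ℓ + u), ℓ^t u)` for `u < ℓ`. [folklore] -/
private theorem not_dvd_choose_pow_mul (t e u : ℕ) (hu : u < ℓ) : ¬ ℓ ∣ (ℓ ^ t * (e * ℓ + u)).choose (ℓ ^ t * u) := by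
  intro h
  have h1 := ((Nat.modEq_zero_iff_dvd.mpr h).symm.trans (choose_pow_mul_modEq_one t e u hu))
  have : ℓ ∣ 1 := (Nat.modEq_iff_dvd' (Nat.zero_le 1)).mp h1
  exact hℓ.out.one_lt.ne' (Nat.dvd_one.mp this)

/-- Lucas: `C(ℓ^r s, ℓ^r) ≡ s (mod ℓ)`. [folklore] -/
private theorem choose_pow_mul_pow_modEq (r s : ℕ) : (ℓ ^ r * s).choose (ℓ ^ r) ≡ s [MOD ℓ] := by
  have h := Choose.choose_pow_mul_pow_mul_modEq_choose_nat (p := ℓ) (k := r) (a := s) (b := 1)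
  rwa [mul_one, Nat.choose_one_right] at h

/-- `ℓ ∤ C(ℓ^r s, ℓ^r)` when `ℓ ∤ s`. [folklore] -/
private theorem not_dvd_choose_pow_mul_pow {r s : ℕ} (hs : ¬ ℓ ∣ s) : ¬ ℓ ∣ (ℓ ^ r * s).choose (ℓ ^ r) := fun h =>
  hs ((Nat.modEq_zero_iff_dvd).mp (((choose_pow_mul_pow_modEq r s).symm.trans (Nat.modEq_zero_iff_dvd.mpr h))))

/-- `ℓ ∣ C(ℓ^(t+1), ℓ^t d)` for `1 ≤ d < ℓ` (Kummer). [folklore] -/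
private theorem dvd_choose_pow_succ {t d : ℕ} (hd : 1 ≤ d) (hdℓ : d < ℓ) : ℓ ∣ (ℓ ^ (t + 1)).choose (ℓ ^ t * d) := by
  refine hℓ.out.dvd_choose_pow ?_ ?_
  · exact Nat.mul_ne_zero (pow_ne_zero _ hℓ.out.ne_zero) (by omega)
  · intro h
    rw [pow_succ] at h
    have := Nat.eq_of_mul_eq_mul_left (pow_pos hℓ.out.pos t) h
    omega

end NumberTheory

/-! ## §2 The field case: zero-propagation from a pivot (Lazard §III, 1°–2°) -/

section FieldCase

variable {K : Type*} [Field K] {ℓ : ℕ} [hℓ : Fact ℓ.Prime] [CharP K ℓ] {n : ℕ} {b : ℕ → K}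

omit hℓ in
/-- Plumbing for zero-propagation in characteristic `ℓ`: from `C • x = C' • y`, `ℓ ∤ C`, and `y = 0` or `ℓ ∣ C'`,
conclude `x = 0`. [folklore] -/
private theorem eq_zero_of_rel {C C' : ℕ} {x y : K} (h : C • x = C' • y) (hC : ¬ ℓ ∣ C) (hy : y = 0 ∨ ℓ ∣ C') :
    x = 0 := by
  have hC0 : (C : K) ≠ 0 := fun h0 => hC ((CharP.cast_eq_zero_iff K ℓ C).mp h0)
  rw [nsmul_eq_mul, nsmul_eq_mul] at h
  have hrhs : (C' : K) * y = 0 := by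
    rcases hy with hy | hy
    · rw [hy, mul_zero]
    · rw [(CharP.cast_eq_zero_iff K ℓ C').mpr hy, zero_mul]
  rw [hrhs] at h
  exact (mul_eq_zero.mp h).resolve_left hC0

/-- **Claim A (below the pivot level everything vanishes).**  Let `ℓ^r ∣ n`, `ℓ^r < n`.  Then `b_i = 0` for every
`1 ≤ i ≤ n-1` with `v_ℓ(i) < r`: writing `i = ℓ^t (e ℓ + d)` (`1 ≤ d ≤ ℓ-1`, `t = v_ℓ(i)`), the relation at
`(ℓ^t d, ℓ^t (ℓ-d))` reads `C(n - ℓ^t d, ℓ^t(ℓ-d)) b_{ℓ^t d} = C(ℓ^{t+1}, ℓ^t d) b_{ℓ^{t+1}}` with a unit on the left and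
`0` on the right (Kummer), and the relation at `(ℓ^t d, ℓ^{t+1} e)` then kills `b_i` (Lucas). [cite: Lazard1955, Lemme 3, §III 1°–2° (pp. 262–263)] -/
theorem IsSymmCocycle.apply_eq_zero_of_factorization_lt (hb : IsSymmCocycle n b) {r : ℕ} (hrn : ℓ ^ r ∣ n)
    (hrn' : ℓ ^ r < n) {i : ℕ} (hi1 : 1 ≤ i) (hin : i ≤ n - 1) (hir : i.factorization ℓ < r) : b i = 0 := by
  have hℓp := hℓ.out
  set t := i.factorization ℓ with ht
  have hi0 : i ≠ 0 := by omega
  -- `i = ℓ^t * q`, `ℓ ∤ q`, `q = e ℓ + d`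
  set q := i / ℓ ^ t with hq
  have hiq : i = ℓ ^ t * q := (Nat.ordProj_mul_ordCompl_eq_self i ℓ).symm
  have hqℓ : ¬ ℓ ∣ q := Nat.not_dvd_ordCompl hℓp hi0
  set d := q % ℓ with hd
  set e := q / ℓ with he
  have hqd : q = e * ℓ + d := by rw [hd, he, Nat.mul_comm, Nat.div_add_mod]
  have hd1 : 1 ≤ d := by
    rcases Nat.eq_zero_or_pos d with h0 | h0
    · exact absurd (Nat.dvd_of_mod_eq_zero h0) hqℓ
    · exact h0
  have hdℓ : d < ℓ := Nat.mod_lt _ hℓp.pos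
  -- sizes: `ℓ^(t+1) ≤ ℓ^r ≤ n - 1`, `ℓ^(t+1) ∣ n`
  have ht1r : t + 1 ≤ r := hir
  have hpow_le : ℓ ^ (t + 1) ≤ ℓ ^ r := Nat.pow_le_pow_right hℓp.pos ht1r
  have hpow_dvd : ℓ ^ (t + 1) ∣ n := (pow_dvd_pow ℓ ht1r).trans hrn
  obtain ⟨N, hN⟩ := hpow_dvd
  have hN1 : 1 ≤ N := by
    rcases Nat.eq_zero_or_pos N with h0 | h0
    · rw [h0, mul_zero] at hN; omega
    · exact h0
  -- Step A1: `b (ℓ^t d) = 0`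
  have hA1 : b (ℓ ^ t * d) = 0 := by
    have hrel := hb.rel (ℓ ^ t * d) (ℓ ^ t * (ℓ - d)) (Nat.mul_pos (pow_pos hℓp.pos t) hd1)
      (Nat.mul_pos (pow_pos hℓp.pos t) (by omega)) (by
        rw [← Nat.mul_add, Nat.add_sub_cancel' hdℓ.le, ← pow_succ]; omega)
    have hsum : ℓ ^ t * d + ℓ ^ t * (ℓ - d) = ℓ ^ (t + 1) := by
      rw [← Nat.mul_add, Nat.add_sub_cancel' hdℓ.le, ← pow_succ]
    rw [hsum] at hrel
    refine eq_zero_of_rel hrel ?_ (Or.inr (dvd_choose_pow_succ hd1 hdℓ))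
    -- `n - ℓ^t d = ℓ^t ((N-1) ℓ + (ℓ - d))`
    have hrew : n - ℓ ^ t * d = ℓ ^ t * ((N - 1) * ℓ + (ℓ - d)) := by
      rw [hN, pow_succ]
      zify [hN1, hdℓ.le]
      have : (ℓ : ℤ) ^ t * d ≤ (ℓ : ℤ) ^ t * ℓ * N := by
        have h1 : (d : ℤ) ≤ ℓ * N := by nlinarith
        nlinarith [pow_pos (show (0 : ℤ) < ℓ by exact_mod_cast hℓp.pos) t]
      rw [Nat.cast_sub (by exact_mod_cast this)]
      push_cast
      ring
    rw [hrew]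
    exact not_dvd_choose_pow_mul t (N - 1) (ℓ - d) (Nat.sub_lt hℓp.pos hd1)
  -- Step A2: `b i = 0`
  rcases Nat.eq_zero_or_pos e with he0 | he0
  · have : i = ℓ ^ t * d := by rw [hiq, hqd, he0, zero_mul, zero_add]
    rw [this]; exact hA1
  · have hrel := hb.rel (ℓ ^ t * d) (ℓ ^ (t + 1) * e) (Nat.mul_pos (pow_pos hℓp.pos t) hd1)
      (Nat.mul_pos (pow_pos hℓp.pos _) he0) (by
        have : ℓ ^ t * d + ℓ ^ (t + 1) * e = i := by rw [hiq, hqd, pow_succ]; ring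
        rw [this]; exact hin)
    have hsum : ℓ ^ t * d + ℓ ^ (t + 1) * e = i := by rw [hiq, hqd, pow_succ]; ring
    rw [hsum] at hrel
    have key := eq_zero_of_rel hrel.symm ?_ (Or.inl hA1)
    · exact key
    · rw [hiq, hqd]
      exact not_dvd_choose_pow_mul t e d hdℓ

/-- **Claim B (at the pivot level everything is determined by the pivot), prime-to-`ℓ` multiples.**  With `P = ℓ^r`,
`b_P = 0` forces `b_{sP} = 0` for `ℓ ∤ s`: the relation at `(P, (s-1)P)` has coefficient `C(sP, P) ≡ s (mod ℓ)` (Lucas).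
[cite: Lazard1955, Lemme 3, §III 1°–2° (pp. 262–263)] -/
theorem IsSymmCocycle.apply_mul_eq_zero_of_not_dvd (hb : IsSymmCocycle n b) {r : ℕ} (hP : b (ℓ ^ r) = 0) {s : ℕ}
    (hs1 : 1 ≤ s) (hs : ¬ ℓ ∣ s) (hsn : ℓ ^ r * s ≤ n - 1) : b (ℓ ^ r * s) = 0 := by
  have hℓp := hℓ.out
  rcases hs1.eq_or_lt with rfl | hs2
  · rw [mul_one]; exact hP
  · have hrel := hb.rel (ℓ ^ r) (ℓ ^ r * (s - 1)) (pow_pos hℓp.pos r)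
      (Nat.mul_pos (pow_pos hℓp.pos r) (by omega)) (by
        rw [mul_tsub, mul_one, Nat.add_sub_cancel' (Nat.le_mul_of_pos_right _ hs1)]; exact hsn)
    have hsum : ℓ ^ r + ℓ ^ r * (s - 1) = ℓ ^ r * s := by
      rw [mul_tsub, mul_one, Nat.add_sub_cancel' (Nat.le_mul_of_pos_right _ hs1)]
    rw [hsum] at hrel
    exact eq_zero_of_rel hrel.symm (not_dvd_choose_pow_mul_pow hs) (Or.inl hP)

/-- **The field case of Lazard's lemma.**  Over a field of characteristic `ℓ` (prime), for `n ≥ 2` there is a pivot index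
`P` (`= ℓ^{v_ℓ(n)}`, or `n/ℓ` when `n` is a power of `ℓ`) such that every coefficient cocycle `b` with `b_P = 0` vanishes
identically — so the cocycles form a `K`-line. [cite: Lazard1955, Lemme 3, §III 1°–2° (pp. 262–263)] -/
theorem exists_pivot (K : Type*) [Field K] (ℓ : ℕ) [Fact ℓ.Prime] [CharP K ℓ] {n : ℕ} (hn : 2 ≤ n) :
    ∃ P : ℕ, ∀ b : ℕ → K, IsSymmCocycle n b → b P = 0 → ∀ i, b i = 0 := by
  have hℓp : ℓ.Prime := Fact.out
  have hn0 : n ≠ 0 := by omega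
  set v := n.factorization ℓ with hv
  -- the pivot exponent
  set r := (if n = ℓ ^ v then v - 1 else v) with hr
  have hrv : r ≤ v := by rw [hr]; split_ifs <;> omega
  have hrn : ℓ ^ r ∣ n := (pow_dvd_pow ℓ hrv).trans (Nat.ordProj_dvd n ℓ)
  have hrn' : ℓ ^ r < n := by
    rw [hr]; split_ifs with h
    · have hv1 : 1 ≤ v := by
        rcases Nat.eq_zero_or_pos v with h0 | h0
        · rw [h0, pow_zero] at h; omega
        · exact h0
      calc ℓ ^ (v - 1) < ℓ ^ v := Nat.pow_lt_pow_right hℓp.one_lt (by omega)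
        _ = n := h.symm
    · exact lt_of_le_of_ne (Nat.le_of_dvd (by omega) (Nat.ordProj_dvd n ℓ)) (Ne.symm h)
  have hℓr : 0 < ℓ ^ r := pow_pos hℓp.pos r
  refine ⟨ℓ ^ r, fun b hb hP => ?_⟩
  -- the multiples `ℓ^r s`, all `s`
  have hB : ∀ s, 1 ≤ s → ℓ ^ r * s ≤ n - 1 → b (ℓ ^ r * s) = 0 := by
    intro s hs1 hsn
    by_cases hs : ℓ ∣ s
    · -- then `n` is not a power of `ℓ`; use symmetry to pass to `(m - s)`, `m = n / ℓ^r`, `ℓ ∤ m - s`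
      have hnpow : n ≠ ℓ ^ v := by
        intro h
        -- `r = v - 1`, `ℓ^r s ≤ ℓ^v - 1` forces `s < ℓ`, contradiction with `ℓ ∣ s`, `s ≥ 1`
        have hr' : r = v - 1 := by rw [hr, if_pos h]
        have hv1 : 1 ≤ v := by
          rcases Nat.eq_zero_or_pos v with h0 | h0
          · rw [h0, pow_zero] at h; omega
          · exact h0
        have hlt : ℓ ^ r * s < ℓ ^ r * ℓ := by
          calc ℓ ^ r * s ≤ n - 1 := hsn
            _ < n := by omega
            _ = ℓ ^ r * ℓ := by rw [h, hr', ← pow_succ, Nat.sub_add_cancel hv1]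
        have hsℓ : s < ℓ := Nat.lt_of_mul_lt_mul_left hlt
        exact absurd (Nat.le_of_dvd (by omega) hs) (not_le.mpr hsℓ)
      have hr' : r = v := by rw [hr, if_neg hnpow]
      set m := n / ℓ ^ r with hm
      have hnm : n = ℓ ^ r * m := by rw [hm, Nat.mul_div_cancel' hrn]
      have hmℓ : ¬ ℓ ∣ m := by rw [hm, hr']; exact Nat.not_dvd_ordCompl hℓp hn0
      have hsm : s < m := by
        rcases lt_or_ge s m with h0 | h0
        · exact h0
        · have : ℓ ^ r * m ≤ ℓ ^ r * s := Nat.mul_le_mul_left _ h0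
          omega
      have hms : ¬ ℓ ∣ (m - s) := fun h0 => hmℓ (by simpa [Nat.sub_add_cancel hsm.le] using Nat.dvd_add h0 hs)
      have hsym := hb.symm' (ℓ ^ r * s) (by omega)
      rw [hsym, show n - ℓ ^ r * s = ℓ ^ r * (m - s) by rw [hnm, Nat.mul_sub]]
      have hpos : 0 < ℓ ^ r * s := Nat.mul_pos hℓr hs1
      exact hb.apply_mul_eq_zero_of_not_dvd hP (by omega) hms (by rw [Nat.mul_sub, ← hnm]; omega)
    · exact hb.apply_mul_eq_zero_of_not_dvd hP hs1 hs hsn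
  -- all indices
  refine hb.eq_zero_of_forall_mem hn (fun i hi => ?_)
  rw [mem_Icc] at hi
  by_cases hir : i.factorization ℓ < r
  · exact hb.apply_eq_zero_of_factorization_lt hrn hrn' hi.1 hi.2 hir
  · -- `ℓ^r ∣ i`
    have hdvd : ℓ ^ r ∣ i := (hℓp.pow_dvd_iff_le_factorization (by omega)).mpr (not_lt.mp hir)
    obtain ⟨s, hs⟩ := hdvd
    have hs1 : 1 ≤ s := by
      rcases Nat.eq_zero_or_pos s with h0 | h0
      · rw [h0, mul_zero] at hs; omega
      · exact h0
    rw [hs]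
    exact hB s hs1 (hs ▸ hi.2)

end FieldCase

/-! ## §3 Dévissage to arbitrary abelian groups and the main theorem -/

section Devissage

variable {A : Type*} [AddCommGroup A]

/-- **A finitely generated nonzero abelian group maps onto some `ℤ/ℓ`, `ℓ` prime** (a maximal proper subgroup has simple
quotient `≅ ℤ/ℓ`) — the rôle played in Lazard's proof by «le théorème fondamental sur les groupes abéliens de type fini».
[cite: Lazard1955, §III (p. 263)] -/
theorem exists_addMonoidHom_zmod_surjective (B : Submodule ℤ A) (hB : B.FG) (hB0 : B ≠ ⊥) :
    ∃ ℓ : ℕ, ℓ.Prime ∧ ∃ φ : B →+ ZMod ℓ, Function.Surjective φ := by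
  haveI : Module.Finite ℤ B := Module.Finite.iff_fg.mpr hB
  haveI : Nontrivial B := (Submodule.nontrivial_iff_ne_bot).mpr hB0
  obtain ⟨N, hN, -⟩ := (eq_top_or_exists_le_coatom (⊥ : Submodule ℤ B)).resolve_left bot_ne_top
  haveI : IsSimpleModule ℤ (B ⧸ N) := (isSimpleModule_iff_isCoatom).mpr hN
  obtain ⟨I, hI, ⟨e⟩⟩ := (isSimpleModule_iff_quot_maximal (R := ℤ) (M := B ⧸ N)).mp inferInstance
  -- `I = (g)` with `g` prime
  obtain ⟨g, hg⟩ := (IsPrincipalIdealRing.principal I).principal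
  have hg' : I = Ideal.span {g} := hg
  haveI := hI
  have hI0 : I ≠ ⊥ := (Ideal.bot_lt_of_maximal I Int.not_isField).ne'
  have hg0 : g ≠ 0 := by
    intro h; apply hI0; rw [hg', h, Ideal.span_singleton_eq_bot]
  have hgp : Prime g := (Ideal.span_singleton_prime hg0).mp (hg' ▸ hI.isPrime)
  refine ⟨g.natAbs, Int.prime_iff_natAbs_prime.mp hgp, ?_⟩
  let ψ : B →+ ZMod g.natAbs :=
    ((Int.quotientSpanEquivZMod g).toAddMonoidHom.comp
      ((Ideal.quotEquivOfEq hg').toAddMonoidHom.comp e.toAddEquiv.toAddMonoidHom)).comp N.mkQ.toAddMonoidHom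
  refine ⟨ψ, fun y => ?_⟩
  obtain ⟨x₁, rfl⟩ := (Int.quotientSpanEquivZMod g).surjective y
  obtain ⟨x₂, rfl⟩ := (Ideal.quotEquivOfEq hg').surjective x₁
  obtain ⟨x₃, rfl⟩ := e.surjective x₂
  obtain ⟨x₄, rfl⟩ := Submodule.mkQ_surjective N x₃
  exact ⟨x₄, rfl⟩

/-- **Key step of the dévissage**: a symmetric 2-cocycle `a` (degree `n ≥ 2`, any abelian group) with `Σ w_m a_m = 0`
for a Bézout vector `Σ w_m c_m = 1` vanishes.  (Otherwise the finitely generated group spanned by the `a_m` maps onto some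
`ℤ/ℓ`; by the field case the image cocycle is a multiple `λ·c̄` of the reduction of `c`, and `λ = Σ w_m (λ c̄_m) = 0`.)
[cite: Lazard1955, Lemme 3, §III (p. 263)] -/
theorem IsSymmCocycle.eq_zero_of_sum_eq_zero {n : ℕ} (hn : 2 ≤ n) {a : ℕ → A} (ha : IsSymmCocycle n a)
    {w : ℕ → ℤ} (hw : ∑ m ∈ range n, w m * (cocycleCoeff n m : ℤ) = 1)
    (h0 : ∑ m ∈ range n, w m • a m = 0) : ∀ i, a i = 0 := by
  classical
  -- the span of the coefficients
  set S : Set A := (fun i => a i) '' ↑(range (n + 1)) with hS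
  set B : Submodule ℤ A := Submodule.span ℤ S with hBdef
  have hmem : ∀ i, a i ∈ B := by
    intro i
    by_cases hi : i ∈ range (n + 1)
    · exact Submodule.subset_span ⟨i, by exact_mod_cast hi, rfl⟩
    · rw [ha.eq_zero_of_lt i (by simp only [mem_range] at hi; omega)]
      exact B.zero_mem
  by_contra hne
  simp only [not_forall] at hne
  obtain ⟨i₀, hi₀⟩ := hne
  have hB0 : B ≠ ⊥ := fun h => hi₀ ((Submodule.mem_bot ℤ).mp (h ▸ hmem i₀))
  have hBfg : B.FG := Submodule.fg_span ((finite_toSet _).image _)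
  obtain ⟨ℓ, hℓp, φ, hφ⟩ := exists_addMonoidHom_zmod_surjective B hBfg hB0
  haveI : Fact ℓ.Prime := ⟨hℓp⟩
  -- the cocycle restricted to `B`, then pushed to `ZMod ℓ`
  let a' : ℕ → B := fun i => ⟨a i, hmem i⟩
  have ha' : IsSymmCocycle n a' := IsSymmCocycle.of_map_injective B.subtype B.injective_subtype ha
  have hb : IsSymmCocycle n (fun i => φ (a' i)) := ha'.map φ
  have hc : IsSymmCocycle n (fun i => (cocycleCoeff n i : ZMod ℓ)) :=
    (isSymmCocycle_cocycleCoeff n).map (Nat.castAddMonoidHom (ZMod ℓ))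
  -- the two sums
  have hsum_b : ∑ m ∈ range n, (w m : ZMod ℓ) * φ (a' m) = 0 := by
    have h1 : (∑ m ∈ range n, w m • a' m) = 0 := by
      apply B.injective_subtype
      rw [map_sum, map_zero]
      simp_rw [map_zsmul]
      exact h0
    have h2 := congrArg φ h1
    rw [map_sum, map_zero] at h2
    rw [← h2]
    refine Finset.sum_congr rfl fun i _ => ?_
    rw [map_zsmul, zsmul_eq_mul]
  have hsum_c : ∑ m ∈ range n, (w m : ZMod ℓ) * (cocycleCoeff n m : ZMod ℓ) = 1 := by
    have := congrArg (Int.cast : ℤ → ZMod ℓ) hw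
    push_cast at this
    exact this
  -- field case
  obtain ⟨P, hP⟩ := exists_pivot (ZMod ℓ) ℓ hn
  have hcP : (cocycleCoeff n P : ZMod ℓ) ≠ 0 := by
    intro h
    have hc0 := hP _ hc h
    have : ∑ m ∈ range n, (w m : ZMod ℓ) * (cocycleCoeff n m : ZMod ℓ) = 0 :=
      Finset.sum_eq_zero fun i _ => by rw [hc0 i, mul_zero]
    rw [hsum_c] at this
    exact one_ne_zero this
  set lam : ZMod ℓ := φ (a' P) / (cocycleCoeff n P : ZMod ℓ) with hlam
  have hδ : IsSymmCocycle n (fun i => φ (a' i) - lam * (cocycleCoeff n i : ZMod ℓ)) :=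
    hb.sub (hc.map (AddMonoidHom.mulLeft lam))
  have hδ0 := hP _ hδ (by show φ (a' P) - lam * _ = 0; rw [hlam, div_mul_cancel₀ _ hcP, sub_self])
  have hbl : ∀ i, φ (a' i) = lam * (cocycleCoeff n i : ZMod ℓ) := fun i => sub_eq_zero.mp (hδ0 i)
  have hlam0 : lam = 0 := by
    have := hsum_b
    simp_rw [hbl, mul_left_comm _ lam, ← Finset.mul_sum, hsum_c, mul_one] at this
    exact this
  have hb0 : ∀ i, φ (a' i) = 0 := fun i => by rw [hbl i, hlam0, zero_mul]
  -- `φ` vanishes on the span: contradiction with surjectivity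
  have hφ0 : ∀ x : B, φ x = 0 := by
    rintro ⟨x, hx⟩
    induction hx using Submodule.span_induction with
    | mem x h =>
      obtain ⟨i, -, rfl⟩ := h
      exact hb0 i
    | zero => exact map_zero φ
    | add x y hx hy hx' hy' =>
      have := map_add φ ⟨x, hx⟩ ⟨y, hy⟩
      rw [hx', hy', add_zero] at this
      exact this
    | smul m x hx hx' =>
      have := map_zsmul φ m ⟨x, hx⟩
      rw [hx', smul_zero] at this
      exact this
  haveI : Fact (1 < ℓ) := ⟨hℓp.one_lt⟩
  obtain ⟨x, hx⟩ := hφ (1 : ZMod ℓ)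
  exact one_ne_zero (hx.symm.trans (hφ0 x))

/-- **LAZARD'S SYMMETRIC 2-COCYCLE LEMMA over any abelian group.**  For `n ≥ 2`, every symmetric 2-cocycle `a` of degree `n`
with values in an abelian group `A` is `a_m = c_m · t` for some `t ∈ A`, `c_m = C(n,m)/ν(n) =` ★ `cocycleCoeff n m`.
[cite: Lazard1955, Lemme 3 (p. 257), §III (pp. 261–264)] -/
theorem IsSymmCocycle.exists_eq_cocycleCoeff_smul {n : ℕ} (hn : 2 ≤ n) {a : ℕ → A} (ha : IsSymmCocycle n a) :
    ∃ t : A, ∀ m, a m = cocycleCoeff n m • t := by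
  obtain ⟨w, hw⟩ := exists_sum_mul_cocycleCoeff_eq_one hn
  refine ⟨∑ m ∈ range n, w m • a m, fun i => ?_⟩
  set t := ∑ m ∈ range n, w m • a m with ht
  have hμ : IsSymmCocycle n (fun m => a m - cocycleCoeff n m • t) := ha.sub (isSymmCocycle_cocycleCoeff_smul n t)
  have h0 : ∑ m ∈ range n, w m • (a m - cocycleCoeff n m • t) = 0 := by
    simp_rw [smul_sub, ← natCast_zsmul t, smul_smul]
    rw [Finset.sum_sub_distrib, ← Finset.sum_smul, hw, one_smul, sub_self]
  exact sub_eq_zero.mp (hμ.eq_zero_of_sum_eq_zero hn hw h0 i)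

/-- **LAZARD'S SYMMETRIC 2-COCYCLE LEMMA, with uniqueness** (the `c_m` are coprime, ★ `eq_zero_of_cocycleCoeff_smul_eq_zero`).
[cite: Lazard1955, Lemme 3 (p. 257), §III (pp. 261–264)] -/
theorem IsSymmCocycle.existsUnique_eq_cocycleCoeff_smul {n : ℕ} (hn : 2 ≤ n) {a : ℕ → A} (ha : IsSymmCocycle n a) :
    ∃! t : A, ∀ m, a m = cocycleCoeff n m • t := by
  obtain ⟨t, ht⟩ := ha.exists_eq_cocycleCoeff_smul hn
  refine ⟨t, ht, fun t' ht' => ?_⟩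
  have : t' - t = 0 := eq_zero_of_cocycleCoeff_smul_eq_zero hn fun m _ _ => by
    rw [smul_sub, ← ht' m, ← ht m, sub_self]
  exact sub_eq_zero.mp this

/-- **Ring form** (Lazard's own statement, coefficientwise): over a commutative ring `R`, a symmetric 2-cocycle of degree
`n ≥ 2` is `a_m = c_m · t`, i.e. `Σ a_m X^m Y^{n-m} = t · C_n(X,Y)`. [cite: Lazard1955, Lemme 3 (p. 257)] -/
theorem IsSymmCocycle.exists_eq_cocycleCoeff_mul {R : Type*} [CommRing R] {n : ℕ} (hn : 2 ≤ n) {a : ℕ → R}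
    (ha : IsSymmCocycle n a) : ∃ t : R, ∀ m, a m = (cocycleCoeff n m : R) * t := by
  obtain ⟨t, ht⟩ := ha.exists_eq_cocycleCoeff_smul hn
  exact ⟨t, fun m => by rw [ht m, nsmul_eq_mul]⟩

end Devissage

end Literature.RingTheory.FormalGroups
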